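import Mathlib.Analysis.SpecialFunctions.Pow.Real
import Mathlib.Analysis.SpecialFunctions.Sqrt
import HarnessLib

/-!
# KST-type RSW: the cascading argument in constant form

Topic `Literature/Probability/Percolation`. The scale-induction of Köhler-Schindler–Tassion
[KohlerSchindlerTassion2023, §2 (sketch with constants) and §5.2], isolated as a statement about
real sequences. Along a tower of scales `m₀ < m₁ < ⋯` (indices `i : ℕ`) let `q i j` be the
probability of the quasi-crossing from scale `i` down to scale `j ≤ i` and `b i` the bridge
probability at scale `i`. Assume

* (P1, Lemma 3) adjacent quasi-crossings are bounded below: `s₀ ≤ q (i+1) i`;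
* (P2, Lemma 4, cascading) for `j ≤ l ≤ i`, with `θ = 1 - √(1 - q i l)`:
  `θ ≤ q i j` or `θ * q l j ≤ 1 - (1 - b l)²`;
* (P3, Lemma 5, closing) `q i j * b j ≤ b i` for `j ≤ i`;
* the base bridge bound `0 ≤ p₀ ≤ b 0`, and `0 ≤ q`, `0 ≤ b`.

Then every `b i` is bounded below by the explicit constant
`θ₀ * min (θ₀² / 4) p₀`, `θ₀ = 1 - √(1 - s₀)` (`cascade_bound`; `θ₀` is written out, no definition is introduced). The proof is the paper's: let
`m` be the last scale `≤ i` with `b m ≥ θ₀²/4` (or the base); by induction `q i m ≥ θ₀`, since at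
every intermediate scale the second alternative of (P2) is excluded by the smallness of `b`; then
(P3) transports the bridge bound from `m` to `i`.

## References

* [KohlerSchindlerTassion2023] L. Köhler-Schindler, V. Tassion, Duke Math. J. 172 (2023), §2, §5.2.
-/

namespace Literature.Probability.Percolation

noncomputable section

namespace KSTPeriodic

/-- `θ₀ > 0` for `s₀ > 0`. [folklore] -/
theorem theta_pos {s₀ : ℝ} (h : 0 < s₀) : 0 < 1 - Real.sqrt (1 - s₀) := by
  have : Real.sqrt (1 - s₀) < 1 := by
    rcases le_or_gt s₀ 1 with h1 | h1
    · calc Real.sqrt (1 - s₀) < Real.sqrt 1 := Real.sqrt_lt_sqrt (by linarith) (by linarith)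
        _ = 1 := Real.sqrt_one
    · rw [Real.sqrt_eq_zero'.2 (by linarith)]; exact one_pos
  linarith

/-- `θ` is monotone: `s₀ ≤ s` implies `θ₀ ≤ 1 - √(1 - s)`. [folklore] -/
theorem theta_mono {s₀ s : ℝ} (h : s₀ ≤ s) : 1 - Real.sqrt (1 - s₀) ≤ 1 - Real.sqrt (1 - s) := by
  have : Real.sqrt (1 - s) ≤ Real.sqrt (1 - s₀) := Real.sqrt_le_sqrt (by linarith)
  linarith

/-- **The cascading argument** [KohlerSchindlerTassion2023, §2 and §5.2] in constant form: under
(P1) `s₀ ≤ q (i+1) i`, (P2) the cascading alternative, (P3) the closing inequality and the base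
bound `p₀ ≤ b 0`, every bridge probability satisfies `θ₀ · min (θ₀²/4) p₀ ≤ b i`.
[cite: KohlerSchindlerTassion2023, §2 (P1)–(P3) and §5.2] -/
theorem cascade_bound {q : ℕ → ℕ → ℝ} {b : ℕ → ℝ} {s₀ p₀ : ℝ} (hs₀ : 0 < s₀) (hs₁ : s₀ ≤ 1)
    (hq0 : ∀ i j, 0 ≤ q i j) (hb0 : ∀ i, 0 ≤ b i)
    (hP1 : ∀ i, s₀ ≤ q (i + 1) i)
    (hP2 : ∀ i l j, j ≤ l → l ≤ i →
      (1 - Real.sqrt (1 - q i l)) ≤ q i j ∨ (1 - Real.sqrt (1 - q i l)) * q l j ≤ 1 - (1 - b l) ^ 2)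
    (hP3 : ∀ i j, j ≤ i → q i j * b j ≤ b i)
    (hp₀ : 0 ≤ p₀) (hbase : p₀ ≤ b 0) (i : ℕ) :
    (1 - Real.sqrt (1 - s₀)) * min ((1 - Real.sqrt (1 - s₀)) ^ 2 / 4) p₀ ≤ b i := by
  set θ₀ := 1 - Real.sqrt (1 - s₀) with hθ₀
  have hθpos : 0 < θ₀ := theta_pos hs₀
  -- `θ₀ ≤ s₀` since `1 - s₀ ≤ √(1 - s₀)` on `[0, 1]`
  have hθle : θ₀ ≤ s₀ := by
    have hx : 0 ≤ 1 - s₀ := by linarith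
    have : 1 - s₀ ≤ Real.sqrt (1 - s₀) := by
      calc 1 - s₀ = Real.sqrt (1 - s₀) * Real.sqrt (1 - s₀) := (Real.mul_self_sqrt hx).symm
        _ ≤ Real.sqrt (1 - s₀) * 1 :=
            mul_le_mul_of_nonneg_left (Real.sqrt_le_one.mpr (by linarith)) (Real.sqrt_nonneg _)
        _ = Real.sqrt (1 - s₀) := mul_one _
    simp only [hθ₀]; linarith
  have hθle1 : θ₀ ≤ 1 := hθle.trans hs₁
  set c₃ := θ₀ ^ 2 / 4 with hc₃
  -- the last good scale `m ≤ i` (bridge probability ≥ c₃), or the base scale `0`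
  classical
  obtain ⟨m, hm_le, hm_good, hbad⟩ :
      ∃ m, m ≤ i ∧ min c₃ p₀ ≤ b m ∧ ∀ l, m < l → l ≤ i → b l < c₃ := by
    by_cases h : ∃ j, j ≤ i ∧ c₃ ≤ b j
    · have hex : ∃ d, c₃ ≤ b (i - d) := by
        obtain ⟨j, hji, hj⟩ := h
        exact ⟨i - j, by rwa [show i - (i - j) = j by omega]⟩
      refine ⟨i - Nat.find hex, Nat.sub_le _ _, (min_le_left _ _).trans (Nat.find_spec hex), ?_⟩
      intro l hml hli
      have hlt : i - l < Nat.find hex := by omega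
      have := Nat.find_min hex hlt
      rw [show i - (i - l) = l by omega] at this
      exact lt_of_not_ge this
    · push Not at h
      exact ⟨0, Nat.zero_le _, (min_le_right _ _).trans hbase, fun l _ hli => h l hli⟩
  -- induction: `θ₀ ≤ q (m + n) m` for `1 ≤ n ≤ i - m`
  have key : ∀ n, 1 ≤ n → m + n ≤ i → θ₀ ≤ q (m + n) m := by
    intro n hn
    induction n with
    | zero => omega
    | succ n ih =>
      intro hni
      rcases Nat.eq_zero_or_pos n with rfl | hnpos
      · -- base: adjacent scales
        calc θ₀ ≤ s₀ := hθle
          _ ≤ q (m + 1) m := hP1 m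
      · have ih' := ih hnpos (by omega)
        have hadj : s₀ ≤ q (m + (n + 1)) (m + n) := by
          have := hP1 (m + n); rwa [show m + n + 1 = m + (n + 1) by omega] at this
        have hθ : θ₀ ≤ 1 - Real.sqrt (1 - q (m + (n + 1)) (m + n)) := theta_mono hadj
        rcases hP2 (m + (n + 1)) (m + n) m (by omega) (by omega) with h | h
        · exact hθ.trans h
        · exfalso
          have hb := hbad (m + n) (by omega) (by omega)
          have hbn := hb0 (m + n)
          have h1 : θ₀ * θ₀ ≤ (1 - Real.sqrt (1 - q (m + (n + 1)) (m + n))) * q (m + n) m :=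
            mul_le_mul hθ ih' hθpos.le ((hθpos.le).trans hθ)
          have h2 : 1 - (1 - b (m + n)) ^ 2 ≤ 2 * b (m + n) := by nlinarith
          have h3 : 2 * b (m + n) < θ₀ ^ 2 := by
            have : c₃ = θ₀ ^ 2 / 4 := rfl
            nlinarith
          nlinarith
  -- transport the bridge bound from `m` to `i`
  have hmin0 : 0 ≤ min c₃ p₀ := le_min (by positivity) hp₀
  rcases Nat.eq_or_lt_of_le hm_le with h | h
  · -- `m = i`: the scale `i` itself is good (or the base)
    rw [← h]
    calc θ₀ * min c₃ p₀ ≤ 1 * min c₃ p₀ := mul_le_mul_of_nonneg_right hθle1 hmin0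
      _ = min c₃ p₀ := one_mul _
      _ ≤ b m := hm_good
  · have hq : θ₀ ≤ q i m := by
      have := key (i - m) (by omega) (by omega)
      rwa [show m + (i - m) = i by omega] at this
    calc θ₀ * min c₃ p₀ ≤ q i m * b m := mul_le_mul hq hm_good hmin0 (hq0 i m)
      _ ≤ b i := hP3 i m hm_le

end KSTPeriodic

end

end Literature.Probability.Percolation
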